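import Literature.Analysis.FluidPDE.Ferrari1993H3BoundRegularity
import Literature.Analysis.FluidPDE.PeriodicCylinderGaussGreen
import HarnessLib

/-!
# The logarithmic `W^{1,∞}` estimate `ShirotaYanagisawa1993_periodicCylinderLogEstimate` from the
stationary log div–curl estimate and the conservation of energy

Topic `Literature/Analysis/FluidPDE`. Third file of the decomposition of the named fact
`Literature.Analysis.FluidPDE.Ferrari1993_periodicCylinderH3Bound` (`Ferrari1993Continuation.lean`;
Ferrari 1993, proof of Thm 2, (4) ⇒ (7)). `Ferrari1993H3Bound.lean` and
`Ferrari1993H3BoundRegularity.lean` prove the target from two analytic named facts, the `H^s`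
energy inequality (Ferrari (13)–(14)) and the logarithmic estimate
`ShirotaYanagisawa1993_periodicCylinderLogEstimate` (Shirota–Yanagisawa 1993, (15) with (17),
p. 80: for a *solution* `u` of the Euler equations in a bounded domain,
`|∇u(t)|_{L^∞} ≤ C{‖u(0)‖₀ + 1 + (1 + log⁺ ‖u(t)‖_s) |rot u(t)|_{L^∞}}`). The printed proof of
(15) (pp. 80–81: the generalized Biot–Savart law (6), the representation (13), the estimates
(18)–(23)) is an estimate for the single field `v = u(t)` with its own energy `‖u(t)‖₀` on the
right, into which the dynamics enter only through the energy inequality (17),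
`‖u(t)‖₀ ≤ ‖u(0)‖₀`, bounding the harmonic components `(u(t), aᵢ)` of (6). This file separates
the two:

1. the **stationary logarithmic div–curl estimate** — for one velocity field `v`, smooth on the
   closed cylinder, `L`-periodic, divergence free and tangential on the wall,
   `sup_{r<1} ‖Dv‖ ≤ C (‖v‖_{L²(cell)} + 1 + (1 + log⁺ ‖v‖_{H³(cell)}) sup |curl v|)` — is vendored
   as the named fact `ShirotaYanagisawa1993_periodicCylinderLogDivCurlEstimate` (the elliptic
   content: Agmon–Douglis–Nirenberg systems, Solonnikov's Green matrices; Ferrari 1993, Prop. 1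
   and (30)–(31), p. 286, for simply connected domains; Beale–Kato–Majda 1984 in the whole space);
2. the **conservation of energy** in the smooth periodic class,
   `‖u(t)‖_{L²(cell)} = ‖u₀‖_{L²(cell)}` (`IsPeriodicCylinderEulerSolution.setIntegral_norm_sq_eq`,
   `….eLpNorm_two_eq`), is **proved**: `d/dt ∫_cell |u|² = ∫_cell 2⟪u, ∂ₜu⟫ = −∫_cell div(|u|² u + 2p u) = 0`
   by the Cartesian Gauss–Green identity on the period cell for fields tangential on the wall and
   periodic in `z` (`setIntegral_divergence_periodCell_eq_zero`, `PeriodicCylinderGaussGreen.lean`)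
   and differentiation under the integral sign (the pattern of
   `KatoLai1984_periodicCylinderUniqueness_holds`, here on the Cartesian cell);
3. the passage from `sup ‖Dv‖` to the tree's full `W^{1,∞}(cell)` norm
   `‖v‖_{L^∞} + Σᵢ ‖∂_{eᵢ} v‖_{L^∞}` is **proved**: `‖v‖_{L^∞(cell)} ≤ vol(cell)^{-1/2} ‖v‖_{L²(cell)} + diam(cell) sup ‖Dv‖`
   on the convex cell (`norm_le_of_eLpNorm_two_le_of_norm_fderiv_le`, mean value inequality and
   averaging), and the infimum in the tree's norm is attained at the classical derivative
   (`MeyersSerrin.eSobolevDomainNorm_succ_eq`).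

Result: `ShirotaYanagisawa1993_periodicCylinderLogEstimate_of_divCurl : 1 → (b)`, and the target on
the `H^s` energy inequality and fact 1 alone,
`Ferrari1993_periodicCylinderH3Bound_of_energyInequality_of_divCurl`.

## Faithfulness / what is NOT here

* Fact 1 is the estimate which the printed proof of Shirota–Yanagisawa's (15) establishes before
  (17) is invoked ((6), (13), (18)–(23) with `‖u(t)‖₀` kept on the right), rendered for fields
  `C^∞` on the closed cylinder (the printed fields are `H^s`, `s > 5/2`; ours are smoother, so
  nothing printed is exceeded), with `sup_{r<1} ‖Dv(x)‖` (operator norm of the classical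
  derivative) for `|∇v|_{L^∞(Ω)}` and the tree's `eSobolevDomainNorm 3 2 (cylinderCell L)` for
  `‖v‖₃`; the right-hand side is monotone in the three sizes, which therefore enter as upper
  bounds `n, e, A`. It inherits the adaptation caveat of the whole chain (bounded smooth domain of
  `ℝ³` → periodic cylinder `{r ≤ 1} × ℝ/Lℤ`, a compact flat manifold with boundary, not simply
  connected: the harmonic fields are the multiples of `e_z`, controlled by the `L²` term — for
  `v = c e_z`, `curl v = 0` and `Dv = 0`).
* Not here: the discharge of fact 1 (elliptic regularity up to the boundary for the div–curl
  system with tangential boundary condition, with the logarithmic interpolation; absent from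
  Mathlib), nor of the `H^s` energy inequality.

Mathlib/tree search: no energy conservation for `IsPeriodicCylinderEulerSolution` /
`IsClassicalEulerOnDomain` in the tree (`lean search 'energy.*periodicCylinder|norm_sq_eq.*Euler'`:
the uniqueness energy method `KatoLai1984_periodicCylinderUniqueness_holds` on the parameter box
only, reused in pattern; the pointwise identity `two_mul_inner_sub_timeDeriv_eq` of
`SpaceTimeSliceCalculus` is reused with the second solution `0`); Gauss–Green on the cell is
`setIntegral_divergence_periodCell_eq_zero`. Used from Mathlib:
`hasDerivAt_integral_of_dominated_loc_of_deriv_le`, `continuousOn_of_dominated`,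
`monotoneOn_of_deriv_nonneg` / `antitoneOn_of_deriv_nonpos`, `Measure.pi_hyperplane` with
`PiLp.volume_preserving_ofLp` (axial level sets are null, so the open cell and the Gauss–Green
cell `{r < 1} × [0, L]` agree a.e.), `Convex.norm_image_sub_le_of_norm_fderiv_le`,
`eLpNorm_le_eLpNorm_mul_rpow_measure_univ`, `MemLp.eLpNorm_eq_integral_rpow_norm`.
-/

noncomputable section

open MeasureTheory Set Function Filter Topology TopologicalSpace WithLp
open scoped ContDiff NNReal ENNReal InnerProductSpace RealInnerProductSpace

namespace Literature.Analysis.FluidPDE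

open Literature.Analysis.FunctionSpaces

/-- Local notation for physical space `ℝ³ = EuclideanSpace ℝ (Fin 3)`. -/
local notation "ℝ³" => EuclideanSpace ℝ (Fin 3)

/-! ### The period cell: the Gauss–Green cell, null axial levels, volume, convexity -/

/-- The open period cell `{r < 1} × (0, L)` lies in the Gauss–Green cell `{r < 1} × [0, L]`.
[folklore] -/
theorem cylinderCell_subset_periodCell (L : ℝ) :
    (cylinderCell L : Set ℝ³) ⊆ {x | cylRadius x < 1 ∧ x 2 ∈ Icc 0 L} :=
  fun _ hx => ⟨hx.1, Ioo_subset_Icc_self hx.2⟩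

/-- The Gauss–Green cell lies in the closed cylinder. [folklore] -/
theorem periodCell_subset_closure_unitCylinder (L : ℝ) :
    {x : ℝ³ | cylRadius x < 1 ∧ x 2 ∈ Icc 0 L} ⊆ closure (unitCylinder : Set ℝ³) :=
  fun _ hx => subset_closure (show _ ∈ (unitCylinder : Set ℝ³) from hx.1)

/-- Axial level sets `{z = c}` are Lebesgue null in `ℝ³` (a coordinate hyperplane,
`Measure.pi_hyperplane`, transported by the measure-preserving `ofLp`). [folklore] -/
theorem volume_setOf_apply_two_eq (c : ℝ) : volume {x : ℝ³ | x 2 = c} = 0 := by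
  have hmp : MeasurePreserving (ofLp : ℝ³ → (Fin 3 → ℝ)) volume volume :=
    PiLp.volume_preserving_ofLp (Fin 3)
  have hset : {x : ℝ³ | x 2 = c} = (ofLp : ℝ³ → (Fin 3 → ℝ)) ⁻¹' {y | y 2 = c} := rfl
  have hmeas : MeasurableSet {y : Fin 3 → ℝ | y 2 = c} :=
    measurableSet_eq_fun (measurable_pi_apply 2) measurable_const
  rw [hset, hmp.measure_preimage hmeas.nullMeasurableSet, volume_pi]
  exact Measure.pi_hyperplane (fun _ : Fin 3 => (volume : Measure ℝ)) (2 : Fin 3) c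

/-- The Gauss–Green cell and the open period cell agree up to a null set (they differ inside the
two axial levels `z = 0`, `z = L`). [folklore] -/
theorem periodCell_ae_eq_cylinderCell (L : ℝ) :
    ({x : ℝ³ | cylRadius x < 1 ∧ x 2 ∈ Icc 0 L} : Set ℝ³) =ᵐ[volume] (cylinderCell L : Set ℝ³) := by
  have hnull : volume ({x : ℝ³ | x 2 = 0} ∪ {x : ℝ³ | x 2 = L}) = 0 :=
    measure_union_null (volume_setOf_apply_two_eq 0) (volume_setOf_apply_two_eq L)
  refine (ae_eq_set.2 ⟨?_, ?_⟩).symm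
  · refine measure_mono_null (fun x hx => ?_) (measure_empty (μ := (volume : Measure ℝ³)))
    exact hx.2 (cylinderCell_subset_periodCell L hx.1)
  · refine measure_mono_null (fun x hx => ?_) hnull
    obtain ⟨⟨hr, hz0, hzL⟩, hx2⟩ := hx
    have hx2' : ¬ (cylRadius x < 1 ∧ x 2 ∈ Ioo 0 L) := hx2
    rcases hz0.lt_or_eq with h0 | h0
    · rcases hzL.lt_or_eq with hL | hL
      · exact absurd ⟨hr, h0, hL⟩ hx2'
      · exact Or.inr hL
    · exact Or.inl h0.symm

/-- The period cell has finite volume. [folklore] -/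
theorem volume_cylinderCell_lt_top (L : ℝ) : volume (cylinderCell L : Set ℝ³) < ⊤ :=
  (measure_mono subset_closure).trans_lt (isCompact_closure_cylinderCell L).measure_lt_top

/-- The period cell has positive volume when `0 < L` (a nonempty open set). [folklore] -/
theorem volume_cylinderCell_pos {L : ℝ} (hL : 0 < L) : 0 < volume (cylinderCell L : Set ℝ³) := by
  refine (cylinderCell L).isOpen.measure_pos volume ⟨(L / 2) • EuclideanSpace.single (2 : Fin 3) (1 : ℝ), ?_⟩
  rw [SetLike.mem_coe, mem_cylinderCell]
  refine ⟨?_, ?_⟩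
  · simp [cylRadius]
  · simp only [PiLp.smul_apply, PiLp.single_apply, if_true, smul_eq_mul, mul_one]
    exact ⟨by linarith, by linarith⟩

/-- The period cell is convex (intersection of the convex cylinder with a slab). [folklore] -/
theorem convex_cylinderCell (L : ℝ) : Convex ℝ (cylinderCell L : Set ℝ³) := by
  have h : (cylinderCell L : Set ℝ³) =
      (unitCylinder : Set ℝ³) ∩ (EuclideanSpace.proj (2 : Fin 3)) ⁻¹' Ioo 0 L := by
    ext x
    simp
  rw [h]
  exact convex_unitCylinder.inter ((convex_Ioo 0 L).linear_preimage
    (EuclideanSpace.proj (2 : Fin 3)).toLinearMap)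

/-- Two points of the period cell are at distance at most `2 √(1 + L²)`. [folklore] -/
theorem norm_sub_le_of_mem_cylinderCell {L : ℝ} {x y : ℝ³} (hx : x ∈ cylinderCell L)
    (hy : y ∈ cylinderCell L) : ‖x - y‖ ≤ 2 * Real.sqrt (1 + L ^ 2) :=
  calc ‖x - y‖ ≤ ‖x‖ + ‖y‖ := norm_sub_le x y
    _ ≤ Real.sqrt (1 + L ^ 2) + Real.sqrt (1 + L ^ 2) :=
        add_le_add (norm_le_of_mem_cylinderCell hx) (norm_le_of_mem_cylinderCell hy)
    _ = 2 * Real.sqrt (1 + L ^ 2) := by ring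

/-! ### Gauss–Green on the open cell and the pointwise energy identity -/

/-- **Gauss–Green on the open period cell**: for `V` of class `C¹` on the closed cylinder,
tangential on the wall and `L`-periodic (`0 < L`), `∫_{cylinderCell L} div V = 0`
(`setIntegral_divergence_periodCell_eq_zero` on the a.e.-equal Gauss–Green cell). [folklore] -/
theorem setIntegral_divergence_cylinderCell_eq_zero {L : ℝ} (hL : 0 < L) {V : ℝ³ → ℝ³}
    (hV : ContDiffOn ℝ 1 V (closure (unitCylinder : Set ℝ³)))
    (hslip : ∀ x ∈ frontier (unitCylinder : Set ℝ³), ⟪V x, eR x⟫ = 0)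
    (hper : IsAxiallyPeriodic L V) :
    ∫ x in (cylinderCell L : Set ℝ³), VectorCalculus.divergence V x = 0 := by
  rw [← setIntegral_congr_set (periodCell_ae_eq_cylinderCell L)]
  exact setIntegral_divergence_periodCell_eq_zero hL hV hslip hper

section PointwiseEnergy

variable {E : Type*} [NormedAddCommGroup E] [InnerProductSpace ℝ E] [FiniteDimensional ℝ E]

/-- **Pointwise energy identity for one Euler solution** (the integrand of
`d/dt ‖u‖₀² = 2(u | ∂ₜu)₀` before integrating by parts; Kato–Lai 1984, (4.10) p. 20): if
`a' = −∇P − (a·∇)a` and `div a = 0` at `x`, then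
`2⟪a, a'⟫ = −div(⟪a, a⟫ a + 2P a)(x)` (`two_mul_inner_sub_timeDeriv_eq` with the second pair
`0`). [folklore] -/
theorem two_mul_inner_timeDeriv_eq_neg_divergence {a a' : E → E} {P : E → ℝ} {x : E}
    (ha : DifferentiableAt ℝ a x) (hP : DifferentiableAt ℝ P x)
    (hma : a' x = -gradient P x - fderiv ℝ a x (a x))
    (hdiva : VectorCalculus.divergence a x = 0) :
    2 * ⟪a x, a' x⟫ =
      -VectorCalculus.divergence (fun y => ⟪a y, a y⟫ • a y + (2 * P y) • a y) x := by
  have hdiv0 : VectorCalculus.divergence (fun _ : E => (0 : E)) x = 0 := by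
    simp [VectorCalculus.divergence]
  have hmb : (fun _ : E => (0 : E)) x =
      -gradient (fun _ : E => (0 : ℝ)) x - fderiv ℝ (fun _ : E => (0 : E)) x ((fun _ : E => (0 : E)) x) := by
    simp
  have h := two_mul_inner_sub_timeDeriv_eq (b := fun _ => (0 : E)) (b' := fun _ => (0 : E))
    (P₂ := fun _ => (0 : ℝ)) ha (differentiableAt_const _) hP (differentiableAt_const _) hma hmb
    hdiva hdiv0
  simpa using h

end PointwiseEnergy

/-! ### Conservation of energy in the smooth periodic class -/

namespace IsPeriodicCylinderEulerSolution

variable {L T : ℝ} {u₀ : ℝ³ → ℝ³} {u : ℝ → ℝ³ → ℝ³} {p : ℝ → ℝ³ → ℝ}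

/-- **The energy production vanishes**: for a solution of the class on `[0, T)` and `s ∈ [0, T)`,
`∫_cell 2⟪u(s), ∂ₜu(s)⟫ = 0`, because `2⟪u, ∂ₜu⟫ = −div(|u|² u + 2p u)` in `{r < 1}`
(`two_mul_inner_timeDeriv_eq_neg_divergence`) and the field `|u|² u + 2p u` is `C¹` on the closed
cylinder, `L`-periodic (velocity **and** pressure are periodic) and tangential on the wall
(`setIntegral_divergence_cylinderCell_eq_zero`). [folklore] -/
theorem setIntegral_two_mul_inner_timeDeriv_eq_zero (hL : 0 < L)
    (h : IsPeriodicCylinderEulerSolution L (Ico 0 T) u₀ u p) {s : ℝ} (hs : s ∈ Ico 0 T) :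
    ∫ x in (cylinderCell L : Set ℝ³), 2 * ⟪u s x, timeDerivWithin (Ico 0 T) u s x⟫ = 0 := by
  set K : Set ℝ³ := closure (unitCylinder : Set ℝ³) with hK
  have hu : ContDiffOn ℝ 1 (uncurry u) (Ico 0 T ×ˢ K) :=
    h.smooth_velocity.of_le (by exact_mod_cast le_top)
  have hq : ContDiffOn ℝ 1 (uncurry p) (Ico 0 T ×ˢ K) :=
    h.smooth_pressure.of_le (by exact_mod_cast le_top)
  have sa : ContDiffOn ℝ 1 (u s) K := contDiffOn_slice_of_contDiffOn_uncurry hu hs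
  have sP : ContDiffOn ℝ 1 (p s) K := contDiffOn_slice_of_contDiffOn_uncurry hq hs
  -- the flux field
  set G : ℝ³ → ℝ³ := fun y => ⟪u s y, u s y⟫ • u s y + (2 * p s y) • u s y with hG
  have hGc : ContDiffOn ℝ 1 G K :=
    ((sa.inner ℝ sa).smul sa).add ((contDiffOn_const.mul sP).smul sa)
  have hGper : IsAxiallyPeriodic L G := fun y => by
    simp only [hG, (h.periodic s hs).1 y, (h.periodic s hs).2 y]
  have hGslip : ∀ x ∈ frontier (unitCylinder : Set ℝ³), ⟪G x, eR x⟫ = 0 := fun x hx => by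
    simp only [hG, inner_add_left, inner_smul_left, h.euler.slip s hs x hx, mul_zero,
      RCLike.conj_to_real, add_zero]
  have hflux : ∫ x in (cylinderCell L : Set ℝ³), VectorCalculus.divergence G x = 0 :=
    setIntegral_divergence_cylinderCell_eq_zero hL hGc hGslip hGper
  -- pointwise identity on the open cell
  have hpt : ∀ x ∈ (cylinderCell L : Set ℝ³),
      2 * ⟪u s x, timeDerivWithin (Ico 0 T) u s x⟫ = -VectorCalculus.divergence G x := by
    intro x hx
    have hxU : x ∈ unitCylinder := cylinderCell_le_unitCylinder L hx
    have hKx : K ∈ 𝓝 x := closure_unitCylinder_mem_nhds hxU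
    have hxK : x ∈ K := subset_closure hxU
    have da : DifferentiableAt ℝ (u s) x := (sa.differentiableOn one_ne_zero x hxK).differentiableAt hKx
    have dP : DifferentiableAt ℝ (p s) x := (sP.differentiableOn one_ne_zero x hxK).differentiableAt hKx
    have ea : timeDerivWithin (Ico 0 T) u s x = -gradient (p s) x - fderiv ℝ (u s) x (u s x) := by
      have hm := h.euler.momentum s hs x hxU
      simp only [convect_apply, Pi.zero_apply, add_zero] at hm
      rw [← hm]
      abel
    exact two_mul_inner_timeDeriv_eq_neg_divergence da dP ea (h.euler.divFree s hs x hxU)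
  rw [setIntegral_congr_fun (cylinderCell L).isOpen.measurableSet hpt, integral_neg, hflux, neg_zero]

/-- **Conservation of energy** (Kato–Lai 1984, §4 (iv)(c), (4.10) p. 20: `(v | (u·∂)v)₀ = 0`;
Shirota–Yanagisawa 1993, (17) p. 80: `‖u(t)‖₀ ≤ ‖u(0)‖₀`; Ferrari 1993, p. 282: "a routine `L²`
energy estimate"): for a solution `(u, p)` of the smooth periodic class on `[0, T)`, `L > 0`, the
energy on the period cell is constant, `∫_cell ‖u(t)‖² = ∫_cell ‖u₀‖²` for `t ∈ [0, T)`. The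
energy is continuous on `[0, T']` (`T' = (t + T)/2`) and differentiable on `(0, T')` with
derivative `∫_cell 2⟪u, ∂ₜu⟫` (differentiation under the integral sign, the integrands being
jointly continuous on the compact `[0, T'] × closure (cell)`), which vanishes
(`setIntegral_two_mul_inner_timeDeriv_eq_zero`). [cite: KatoLai1984, §4 (iv)(c) eq. (4.10) p. 20]
[cite: ShirotaYanagisawa1993, (17) p. 80] -/
theorem setIntegral_norm_sq_eq (hL : 0 < L) (h : IsPeriodicCylinderEulerSolution L (Ico 0 T) u₀ u p)
    {t : ℝ} (ht : t ∈ Ico 0 T) :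
    ∫ x in (cylinderCell L : Set ℝ³), ‖u t x‖ ^ 2 = ∫ x in (cylinderCell L : Set ℝ³), ‖u₀ x‖ ^ 2 := by
  -- notation and basic facts
  set S : Set ℝ := Ico 0 T with hS_def
  set K : Set ℝ³ := closure (unitCylinder : Set ℝ³) with hK_def
  set Ω : Set ℝ³ := (cylinderCell L : Set ℝ³) with hΩ_def
  have hS : UniqueDiffOn ℝ S := uniqueDiffOn_Ico 0 T
  have hKu : UniqueDiffOn ℝ K := uniqueDiffOn_closure_unitCylinder
  set T' : ℝ := (t + T) / 2 with hT'_def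
  have htT' : t < T' := by rw [hT'_def]; linarith [ht.2]
  have hT'T : T' < T := by rw [hT'_def]; linarith [ht.2]
  have hT'0 : 0 < T' := ht.1.trans_lt htT'
  have hIccS : Icc 0 T' ⊆ S := fun s hs => ⟨hs.1, hs.2.trans_lt hT'T⟩
  have hIooS : Ioo 0 T' ⊆ S := fun s hs => ⟨hs.1.le, hs.2.trans hT'T⟩
  have hSnhds : ∀ s ∈ Ioo 0 T', S ∈ 𝓝 s := fun s hs =>
    mem_of_superset (Ioo_mem_nhds hs.1 (hs.2.trans hT'T)) Ioo_subset_Ico_self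
  have hΩK : closure Ω ⊆ K := closure_cylinderCell_subset L
  -- smoothness (`C¹` suffices)
  have hu : ContDiffOn ℝ 1 (uncurry u) (S ×ˢ K) := h.smooth_velocity.of_le (by exact_mod_cast le_top)
  have cu : ContinuousOn (uncurry u) (S ×ˢ K) := hu.continuousOn
  have cu' : ContinuousOn (uncurry (timeDerivWithin S u)) (S ×ˢ K) :=
    continuousOn_uncurry_timeDerivWithin hu le_rfl hS hKu
  -- the energy and the energy production on the cell
  set e : ℝ → ℝ := fun s => ∫ x in Ω, ‖u s x‖ ^ 2 with he
  set φ : ℝ → ℝ := fun s => ∫ x in Ω, 2 * ⟪u s x, timeDerivWithin S u s x⟫ with hφ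
  -- `[0, T'] × closure Ω` is compact and lies in `S × K`
  have hQc : IsCompact (Icc (0 : ℝ) T' ×ˢ closure Ω) :=
    isCompact_Icc.prod (isCompact_closure_cylinderCell L)
  have hQsub : Icc (0 : ℝ) T' ×ˢ closure Ω ⊆ S ×ˢ K := prod_mono hIccS hΩK
  have cF : ContinuousOn (fun z : ℝ × ℝ³ => ‖u z.1 z.2‖ ^ 2) (Icc 0 T' ×ˢ closure Ω) :=
    ((cu.mono hQsub).norm.pow 2)
  have cF' : ContinuousOn (fun z : ℝ × ℝ³ => 2 * ⟪u z.1 z.2, timeDerivWithin S u z.1 z.2⟫)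
      (Icc 0 T' ×ˢ closure Ω) :=
    continuousOn_const.mul ((cu.mono hQsub).inner (cu'.mono hQsub))
  -- uniform bounds by compactness
  obtain ⟨C₀, hC₀⟩ := hQc.exists_bound_of_continuousOn cF
  obtain ⟨C₁, hC₁⟩ := hQc.exists_bound_of_continuousOn cF'
  -- slices at fixed time / fixed point
  have hιx : ∀ s : ℝ, Continuous fun x : ℝ³ => ((s, x) : ℝ × ℝ³) := fun s =>
    continuous_const.prodMk continuous_id
  have hιs : ∀ x : ℝ³, Continuous fun s : ℝ => ((s, x) : ℝ × ℝ³) := fun x =>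
    continuous_id.prodMk continuous_const
  have cFs : ∀ s ∈ Icc (0 : ℝ) T', ContinuousOn (fun x => ‖u s x‖ ^ 2) (closure Ω) :=
    fun s hs => cF.comp (f := fun x : ℝ³ => ((s, x) : ℝ × ℝ³)) (hιx s).continuousOn
      fun x hx => ⟨hs, hx⟩
  have cF's : ∀ s ∈ Icc (0 : ℝ) T',
      ContinuousOn (fun x => 2 * ⟪u s x, timeDerivWithin S u s x⟫) (closure Ω) :=
    fun s hs => cF'.comp (f := fun x : ℝ³ => ((s, x) : ℝ × ℝ³)) (hιx s).continuousOn
      fun x hx => ⟨hs, hx⟩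
  have cFp : ∀ x ∈ closure Ω, ContinuousOn (fun s => ‖u s x‖ ^ 2) (Icc 0 T') :=
    fun x hx => cF.comp (f := fun s : ℝ => ((s, x) : ℝ × ℝ³)) (hιs x).continuousOn
      fun s hs => ⟨hs, hx⟩
  -- measure facts on the cell
  have hΩmeas : MeasurableSet Ω := (cylinderCell L).isOpen.measurableSet
  have hΩfin : volume Ω ≠ ⊤ := (volume_cylinderCell_lt_top L).ne
  have hmemΩ : ∀ᵐ x ∂(volume.restrict Ω), x ∈ closure Ω :=
    (ae_restrict_mem hΩmeas).mono fun x hx => subset_closure hx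
  have hintF : ∀ s ∈ Icc (0 : ℝ) T', IntegrableOn (fun x => ‖u s x‖ ^ 2) Ω volume := fun s hs =>
    ((cFs s hs).integrableOn_compact (isCompact_closure_cylinderCell L)).mono_set subset_closure
  -- (B1) the energy is continuous on `[0, T']`
  have hB1 : ContinuousOn e (Icc 0 T') := by
    refine continuousOn_of_dominated (μ := volume.restrict Ω) (bound := fun _ => C₀)
      (fun s hs => ((cFs s hs).mono subset_closure).aestronglyMeasurable hΩmeas)
      (fun s hs => hmemΩ.mono fun x hx => hC₀ (s, x) ⟨hs, hx⟩) (integrableOn_const hΩfin)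
      (hmemΩ.mono fun x hx => cFp x hx)
  -- (B2) the energy is differentiable on `(0, T')` with derivative `φ`
  have hB2 : ∀ s ∈ Ioo 0 T', HasDerivAt e (φ s) s := by
    intro s hs
    have hsI : s ∈ Icc 0 T' := Ioo_subset_Icc_self hs
    have hIoo : Ioo 0 T' ∈ 𝓝 s := Ioo_mem_nhds hs.1 hs.2
    have key := hasDerivAt_integral_of_dominated_loc_of_deriv_le (μ := volume.restrict Ω)
      (F := fun σ x => ‖u σ x‖ ^ 2)
      (F' := fun σ x => 2 * ⟪u σ x, timeDerivWithin S u σ x⟫) (x₀ := s)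
      (bound := fun _ => C₁) hIoo ?_ (hintF s hsI)
      (((cF's s hsI).mono subset_closure).aestronglyMeasurable hΩmeas) ?_
      (integrableOn_const hΩfin) ?_
    · exact key.2
    · filter_upwards [hIoo] with σ hσ
      exact ((cFs σ (Ioo_subset_Icc_self hσ)).mono subset_closure).aestronglyMeasurable hΩmeas
    · exact hmemΩ.mono fun x hx σ hσ => hC₁ (σ, x) ⟨Ioo_subset_Icc_self hσ, hx⟩
    · refine hmemΩ.mono fun x hx σ hσ => ?_
      have hσS : σ ∈ S := hIooS hσ
      have hxK : x ∈ K := hΩK hx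
      exact (hasDerivAt_time_of_contDiffOn hu one_ne_zero hS hσS (hSnhds σ hσ) hxK).norm_sq
  -- (B3) the energy production vanishes
  have hB3 : ∀ s ∈ Ioo (0 : ℝ) T', φ s = 0 := fun s hs =>
    h.setIntegral_two_mul_inner_timeDeriv_eq_zero hL (hIooS hs)
  -- (B4) so the energy is constant on `[0, T']`
  have hderiv : ∀ s ∈ interior (Icc (0 : ℝ) T'), deriv e s = 0 := by
    rw [interior_Icc]
    intro s hs
    rw [(hB2 s hs).deriv, hB3 s hs]
  have hdiff : DifferentiableOn ℝ e (interior (Icc (0 : ℝ) T')) := by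
    rw [interior_Icc]
    exact fun s hs => (hB2 s hs).differentiableAt.differentiableWithinAt
  have hmono : MonotoneOn e (Icc 0 T') :=
    monotoneOn_of_deriv_nonneg (convex_Icc 0 T') hB1 hdiff fun s hs => (hderiv s hs).ge
  have hanti : AntitoneOn e (Icc 0 T') :=
    antitoneOn_of_deriv_nonpos (convex_Icc 0 T') hB1 hdiff fun s hs => (hderiv s hs).le
  have htI : t ∈ Icc 0 T' := ⟨ht.1, htT'.le⟩
  have h0I : (0 : ℝ) ∈ Icc 0 T' := left_mem_Icc.2 hT'0.le
  have het : e t = e 0 := le_antisymm (hanti h0I htI ht.1) (hmono h0I htI ht.1)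
  simpa only [he, h.initial] using het

/-- The slices of a solution of the class are in `L²(cell)` (continuous on the compact closure).
[folklore] -/
theorem memLp_two_slice (h : IsPeriodicCylinderEulerSolution L (Ico 0 T) u₀ u p) {t : ℝ}
    (ht : t ∈ Ico 0 T) :
    MemLp (u t) 2 (volume.restrict (cylinderCell L : Set ℝ³)) := by
  have hc : ContinuousOn (u t) (closure (unitCylinder : Set ℝ³)) :=
    (contDiffOn_slice_of_contDiffOn_uncurry h.smooth_velocity ht).continuousOn
  refine ⟨(hc.mono (subset_closure.trans (closure_cylinderCell_subset L))).aestronglyMeasurable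
    (cylinderCell L).isOpen.measurableSet, ?_⟩
  exact eLpNorm_restrict_lt_top_of_continuousOn_isCompact (isCompact_closure_cylinderCell L)
    subset_closure (hc.mono (closure_cylinderCell_subset L)) 2

/-- **Conservation of energy, `L²`-norm form**: `‖u(t)‖_{L²(cell)} = ‖u₀‖_{L²(cell)}` for a
solution of the smooth periodic class on `[0, T)`, `L > 0`, `t ∈ [0, T)` (Shirota–Yanagisawa
1993, (17) p. 80, with equality). [cite: ShirotaYanagisawa1993, (17) p. 80] -/
theorem eLpNorm_two_eq (hL : 0 < L) (h : IsPeriodicCylinderEulerSolution L (Ico 0 T) u₀ u p)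
    {t : ℝ} (ht : t ∈ Ico 0 T) :
    eLpNorm (u t) 2 (volume.restrict (cylinderCell L : Set ℝ³)) =
      eLpNorm u₀ 2 (volume.restrict (cylinderCell L : Set ℝ³)) := by
  have h0 : (0 : ℝ) ∈ Ico 0 T := ⟨le_rfl, ht.1.trans_lt ht.2⟩
  have e1 := (h.memLp_two_slice ht).eLpNorm_eq_integral_rpow_norm two_ne_zero ENNReal.ofNat_ne_top
  have e2 := (h.memLp_two_slice h0).eLpNorm_eq_integral_rpow_norm two_ne_zero ENNReal.ofNat_ne_top
  rw [h.initial] at e2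
  rw [e1, e2]
  congr 2
  have key := h.setIntegral_norm_sq_eq hL ht
  simp only [ENNReal.toReal_ofNat, Real.rpow_two]
  exact key

end IsPeriodicCylinderEulerSolution

/-! ### From a gradient bound to the `L^∞` and `W^{1,∞}` norms on the cell -/

/-- **Sup bound on the convex cell from the energy and a gradient bound**: if `v` is continuous on
the closed cylinder, differentiable on the open cell with `‖Dv‖ ≤ G` there, and
`‖v‖_{L²(cell)} ≤ e`, then for every `x` in the cell
`‖v(x)‖ ≤ vol(cell)^{-1/2} e + 2√(1 + L²) G` (mean value inequality on the convex cell,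
`‖v(x)‖ ≤ ‖v(y)‖ + G ‖x − y‖`, averaged over `y`, and `‖v‖_{L¹} ≤ vol^{1/2} ‖v‖_{L²}`). [folklore] -/
theorem norm_le_of_eLpNorm_two_le_of_norm_fderiv_le {L : ℝ} (hL : 0 < L) {v : ℝ³ → ℝ³}
    (hvc : ContinuousOn v (closure (unitCylinder : Set ℝ³)))
    (hvd : ∀ x ∈ (cylinderCell L : Set ℝ³), DifferentiableAt ℝ v x) {G : ℝ}
    (hG : ∀ x ∈ (cylinderCell L : Set ℝ³), ‖fderiv ℝ v x‖ ≤ G) {e : ℝ≥0}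
    (he : eLpNorm v 2 (volume.restrict (cylinderCell L : Set ℝ³)) ≤ e) {x : ℝ³}
    (hx : x ∈ (cylinderCell L : Set ℝ³)) :
    ‖v x‖ ≤ ((volume (cylinderCell L : Set ℝ³)).toReal ^ (1 / 2 : ℝ))⁻¹ * e +
      2 * Real.sqrt (1 + L ^ 2) * G := by
  set Ω : Set ℝ³ := (cylinderCell L : Set ℝ³) with hΩ_def
  have hΩmeas : MeasurableSet Ω := (cylinderCell L).isOpen.measurableSet
  have hΩfin : volume Ω < ⊤ := volume_cylinderCell_lt_top L
  have hΩpos : 0 < volume Ω := volume_cylinderCell_pos hL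
  set V : ℝ := (volume Ω).toReal with hV
  have hVpos : 0 < V := ENNReal.toReal_pos hΩpos.ne' hΩfin.ne
  have hG0 : 0 ≤ G := (norm_nonneg _).trans (hG x hx)
  set D : ℝ := 2 * Real.sqrt (1 + L ^ 2) with hD
  -- mean value inequality on the convex cell
  have hmv : ∀ y ∈ Ω, ‖v x‖ ≤ ‖v y‖ + G * D := by
    intro y hy
    have h1 : ‖v x - v y‖ ≤ G * ‖x - y‖ :=
      (convex_cylinderCell L).norm_image_sub_le_of_norm_fderiv_le hvd hG hy hx
    have h2 : ‖x - y‖ ≤ D := norm_sub_le_of_mem_cylinderCell hx hy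
    calc ‖v x‖ = ‖v y + (v x - v y)‖ := by rw [add_sub_cancel]
      _ ≤ ‖v y‖ + ‖v x - v y‖ := norm_add_le _ _
      _ ≤ ‖v y‖ + G * D := by gcongr; exact h1.trans (by gcongr)
  -- integrability of `‖v‖` on the cell and the `L¹ ≤ vol^{1/2} L²` bound
  have hvc' : ContinuousOn v (closure Ω) := hvc.mono (closure_cylinderCell_subset L)
  have hint : IntegrableOn (fun y => ‖v y‖) Ω volume :=
    ((hvc'.norm.integrableOn_compact (isCompact_closure_cylinderCell L)).mono_set subset_closure)
  have hmeasv : AEStronglyMeasurable v (volume.restrict Ω) :=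
    (hvc'.mono subset_closure).aestronglyMeasurable hΩmeas
  have hL1 : ∫ y in Ω, ‖v y‖ ≤ V ^ (1 / 2 : ℝ) * e := by
    have h1 : eLpNorm v 1 (volume.restrict Ω) ≤
        eLpNorm v 2 (volume.restrict Ω) * (volume.restrict Ω) univ ^ (1 / (1 : ℝ≥0∞).toReal - 1 / (2 : ℝ≥0∞).toReal) :=
      eLpNorm_le_eLpNorm_mul_rpow_measure_univ (by norm_num) hmeasv
    rw [Measure.restrict_apply_univ] at h1
    have hexp : (1 / (1 : ℝ≥0∞).toReal - 1 / (2 : ℝ≥0∞).toReal : ℝ) = 1 / 2 := by norm_num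
    rw [hexp] at h1
    have h2 : eLpNorm v 1 (volume.restrict Ω) ≤ (e : ℝ≥0∞) * volume Ω ^ (1 / 2 : ℝ) :=
      h1.trans (by gcongr)
    have h3 : ∫ y in Ω, ‖v y‖ = (eLpNorm v 1 (volume.restrict Ω)).toReal := by
      rw [eLpNorm_one_eq_lintegral_enorm, integral_norm_eq_lintegral_enorm hmeasv]
    rw [h3]
    have hfin : (e : ℝ≥0∞) * volume Ω ^ (1 / 2 : ℝ) ≠ ⊤ :=
      ENNReal.mul_ne_top ENNReal.coe_ne_top (ENNReal.rpow_ne_top_of_nonneg (by norm_num) hΩfin.ne)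
    have h4 := ENNReal.toReal_mono hfin h2
    rw [ENNReal.toReal_mul, ENNReal.coe_toReal, ← ENNReal.toReal_rpow] at h4
    linarith [h4, mul_comm (e : ℝ) (V ^ (1 / 2 : ℝ))]
  -- average the mean value inequality over the cell
  have hconst : ∫ _ in Ω, ‖v x‖ = V * ‖v x‖ := by
    rw [setIntegral_const, smul_eq_mul, Measure.real, hV]
  have hle : ∫ _ in Ω, ‖v x‖ ≤ ∫ y in Ω, (‖v y‖ + G * D) := by
    refine setIntegral_mono_on (integrableOn_const hΩfin.ne) (hint.add (integrableOn_const hΩfin.ne))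
      hΩmeas fun y hy => hmv y hy
  rw [hconst, integral_add hint (integrableOn_const hΩfin.ne), setIntegral_const, smul_eq_mul,
    Measure.real] at hle
  have hle' : V * ‖v x‖ ≤ V ^ (1 / 2 : ℝ) * e + V * (G * D) := by rw [hV]; linarith
  have hVhalf : V = V ^ (1 / 2 : ℝ) * V ^ (1 / 2 : ℝ) := by
    rw [← Real.rpow_add hVpos]; norm_num
  have hVhpos : 0 < V ^ (1 / 2 : ℝ) := Real.rpow_pos_of_pos hVpos _
  have key : ‖v x‖ ≤ (V ^ (1 / 2 : ℝ))⁻¹ * e + G * D := by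
    rw [hVhalf] at hle'
    have h5 : V ^ (1 / 2 : ℝ) * ‖v x‖ ≤ e + V ^ (1 / 2 : ℝ) * (G * D) := by
      have := hle'
      nlinarith [hVhpos]
    calc ‖v x‖ = (V ^ (1 / 2 : ℝ))⁻¹ * (V ^ (1 / 2 : ℝ) * ‖v x‖) := by
          field_simp
      _ ≤ (V ^ (1 / 2 : ℝ))⁻¹ * (e + V ^ (1 / 2 : ℝ) * (G * D)) := by gcongr
      _ = (V ^ (1 / 2 : ℝ))⁻¹ * e + G * D := by field_simp
  calc ‖v x‖ ≤ (V ^ (1 / 2 : ℝ))⁻¹ * e + G * D := key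
    _ = (V ^ (1 / 2 : ℝ))⁻¹ * e + D * G := by ring
    _ = ((volume (cylinderCell L : Set ℝ³)).toReal ^ (1 / 2 : ℝ))⁻¹ * e +
          2 * Real.sqrt (1 + L ^ 2) * G := by rw [hD]

/-- **The `W^{1,∞}(cell)` norm from pointwise bounds**: if `v` is `C^∞` on the closed cylinder with
`‖v‖ ≤ a` and `‖Dv‖ ≤ G` on the open cell, then
`‖v‖_{W^{1,∞}(cell)} ≤ a + (Σᵢ ‖eᵢ‖) G`, `(eᵢ)` the basis `Module.finBasis` of the tree's norm (the
infimum in the norm is attained at the classical derivative, `MeyersSerrin.eSobolevDomainNorm_succ_eq`,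
and `L^∞` norms are bounded by pointwise bounds). [folklore] -/
theorem eSobolevDomainNorm_one_top_le_of_bounds {L : ℝ} {v : ℝ³ → ℝ³}
    (hv : ContDiffOn ℝ ∞ v (closure (unitCylinder : Set ℝ³))) {a G : ℝ} (ha0 : 0 ≤ a) (hG0 : 0 ≤ G)
    (ha : ∀ x ∈ (cylinderCell L : Set ℝ³), ‖v x‖ ≤ a)
    (hG : ∀ x ∈ (cylinderCell L : Set ℝ³), ‖fderiv ℝ v x‖ ≤ G) :
    eSobolevDomainNorm 1 ∞ (cylinderCell L) volume v ≤
      ENNReal.ofReal (a + (∑ i, ‖Module.finBasis ℝ ℝ³ i‖) * G) := by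
  have hΩmeas : MeasurableSet (cylinderCell L : Set ℝ³) := (cylinderCell L).isOpen.measurableSet
  have hvΩ : ContDiffOn ℝ ∞ v (cylinderCell L : Set ℝ³) :=
    hv.mono (fun x hx => subset_closure (cylinderCell_le_unitCylinder L hx))
  rw [MeyersSerrin.eSobolevDomainNorm_succ_eq (p := ∞) (k := 0)
    (MeyersSerrin.hasWeakFDerivOn_of_contDiffOn (μ := volume) hvΩ)]
  simp only [eSobolevDomainNorm_zero]
  have h1 : eLpNorm v ∞ (volume.restrict (cylinderCell L : Set ℝ³)) ≤ ENNReal.ofReal a := by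
    rw [eLpNorm_exponent_top]
    exact eLpNormEssSup_le_of_ae_bound ((ae_restrict_iff' hΩmeas).2 (Eventually.of_forall ha))
  have h2 : ∀ i, eLpNorm (fun x => fderiv ℝ v x (Module.finBasis ℝ ℝ³ i)) ∞
      (volume.restrict (cylinderCell L : Set ℝ³)) ≤ ENNReal.ofReal (‖Module.finBasis ℝ ℝ³ i‖ * G) := by
    intro i
    rw [eLpNorm_exponent_top]
    refine eLpNormEssSup_le_of_ae_bound ((ae_restrict_iff' hΩmeas).2 (Eventually.of_forall ?_))
    intro x hx
    calc ‖fderiv ℝ v x (Module.finBasis ℝ ℝ³ i)‖ ≤ ‖fderiv ℝ v x‖ * ‖Module.finBasis ℝ ℝ³ i‖ :=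
          ContinuousLinearMap.le_opNorm _ _
      _ ≤ G * ‖Module.finBasis ℝ ℝ³ i‖ := by gcongr; exact hG x hx
      _ = ‖Module.finBasis ℝ ℝ³ i‖ * G := mul_comm _ _
  calc eLpNorm v ∞ (volume.restrict (cylinderCell L : Set ℝ³)) +
        ∑ i, eLpNorm (fun x => fderiv ℝ v x (Module.finBasis ℝ ℝ³ i)) ∞
          (volume.restrict (cylinderCell L : Set ℝ³))
      ≤ ENNReal.ofReal a + ∑ i, ENNReal.ofReal (‖Module.finBasis ℝ ℝ³ i‖ * G) :=
        add_le_add h1 (Finset.sum_le_sum fun i _ => h2 i)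
    _ = ENNReal.ofReal (a + (∑ i, ‖Module.finBasis ℝ ℝ³ i‖) * G) := by
        rw [← ENNReal.ofReal_sum_of_nonneg (fun i _ => by positivity), ← ENNReal.ofReal_add ha0
          (Finset.sum_nonneg fun i _ => by positivity), Finset.sum_mul]

/-! ### The stationary fact and the reduction -/

/-- **The logarithmic div–curl estimate in the periodic cylinder, stationary form** (the estimate
established by the printed proof of Shirota–Yanagisawa 1993, (15), pp. 80–81 — generalized
Biot–Savart law (6) `u = Σᵢ (u, aᵢ) aᵢ + R[du]`, representation (13), harmonic part (17), kernel
estimates (18)–(23) — *before* the energy inequality `‖u(t)‖₀ ≤ ‖u(0)‖₀` of (17) is invoked, i.e.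
with the field's own `L²` norm on the right: for a bounded domain `Ω ⊂ ℝ³` with smooth boundary
and `v ∈ H^s(Ω)`, `s > 5/2`, divergence free and tangential on `∂Ω`,
`|∇v|_{L^∞(Ω)} ≤ C{‖v‖₀ + 1 + (1 + log⁺ ‖v‖_s) |rot v|_{L^∞(Ω)}}`; for `Ω` simply connected (no
harmonic fields) Ferrari 1993, Prop. 1 (30) with Cor. 1 (31), p. 286:
`|v|_{W^{1,∞}} ≤ C[(1 + log⁺ |v|_{H³}) |curl v|_{L^∞} + 1]`; whole space: Beale–Kato–Majda 1984).
**Rendering** (`s = 3`; periodic cylinder; fields `C^∞` on the closed cylinder `{r ≤ 1}`,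
`L`-periodic in `z`, divergence free in `{r < 1}`, tangential on `{r = 1}` — the time slices of
the class `IsPeriodicCylinderEulerSolution`; `|∇v|_{L^∞}` as the supremum over `{r < 1}` of the
operator norm of the classical derivative; `‖v‖₃` by the tree's
`eSobolevDomainNorm 3 2 (cylinderCell L) volume`, `‖v‖₀` by `eLpNorm v 2` on the open period cell;
the right-hand side is monotone in the three sizes, which enter as upper bounds `n, e, A`): for
`L > 0` there is `C` such that for every such `v` and all `n, e, A ≥ 0` with
`‖v‖_{H³(cell)} ≤ n`, `‖v‖_{L²(cell)} ≤ e`, `|curl v| ≤ A` on `{r < 1}`, one has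
`‖Dv(x)‖ ≤ C (e + 1 + (1 + log⁺ n) A)` for all `x` with `r(x) < 1`. Adaptation caveat as in
`Ferrari1993_periodicCylinderH3Bound`: the printed estimates concern bounded smooth domains of
`ℝ³`; the periodic cylinder `{r ≤ 1} × ℝ/Lℤ` is a compact flat manifold with boundary, not simply
connected — its harmonic fields (divergence free, curl free, tangential, periodic) are the
multiples of `e_z`, whence the `L²` term (for `v = c e_z`, `curl v = 0`, `Dv = 0`); this is the
use made of these results by Luo–Hou 2014 §4.4 and Chen–Hou 2021 §9. Combined with the proved
conservation of energy it yields `ShirotaYanagisawa1993_periodicCylinderLogEstimate`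
(`ShirotaYanagisawa1993_periodicCylinderLogEstimate_of_divCurl`). [cite: ShirotaYanagisawa1993, proof of (15) pp. 80–81 ((6), (13), (17)–(23))]
[cite: Ferrari1993, Prop. 1 (30) and Cor. 1 (31), p. 286 (simply connected case)]
[cite: LuoHou2014, §4.4 p. 1744 (use in the periodic cylinder)] -/
def ShirotaYanagisawa1993_periodicCylinderLogDivCurlEstimate : Prop :=
  ∀ (L : ℝ) (_hL : 0 < L), ∃ C : ℝ≥0, ∀ (v : ℝ³ → ℝ³)
    (_hv : ContDiffOn ℝ ∞ v (closure (unitCylinder : Set ℝ³)))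
    (_hper : IsAxiallyPeriodic L v)
    (_hdiv : ∀ x ∈ (unitCylinder : Set ℝ³), VectorCalculus.divergence v x = 0)
    (_hslip : ∀ x ∈ frontier (unitCylinder : Set ℝ³), ⟪v x, eR x⟫ = 0) (n e A : ℝ≥0)
    (_hn : eSobolevDomainNorm 3 2 (cylinderCell L) volume v ≤ n)
    (_he : eLpNorm v 2 (volume.restrict (cylinderCell L : Set ℝ³)) ≤ e)
    (_hA : ∀ x ∈ (unitCylinder : Set ℝ³), ‖curl v x‖ ≤ A),
    ∀ x ∈ (unitCylinder : Set ℝ³), ‖fderiv ℝ v x‖ ≤ C * (e + 1 + (1 + Real.posLog n) * A)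

/-- **`ShirotaYanagisawa1993_periodicCylinderLogEstimate` from the stationary div–curl estimate**
(Shirota–Yanagisawa 1993, proof of (15) with (17), p. 80): apply the stationary estimate to the
slice `v = u(t)` (smooth on the closed cylinder, periodic, divergence free, tangential), feed the
energy of the datum through the proved conservation of energy
(`IsPeriodicCylinderEulerSolution.eLpNorm_two_eq`), and pass from the gradient bound to the tree's
`W^{1,∞}(cell)` norm (`norm_le_of_eLpNorm_two_le_of_norm_fderiv_le`,
`eSobolevDomainNorm_one_top_le_of_bounds`); the constant becomes
`vol(cell)^{-1/2} + (2√(1+L²) + Σᵢ ‖eᵢ‖) C`. [cite: ShirotaYanagisawa1993, (15) and (17) p. 80] -/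
theorem ShirotaYanagisawa1993_periodicCylinderLogEstimate_of_divCurl
    (hDC : ShirotaYanagisawa1993_periodicCylinderLogDivCurlEstimate) :
    ShirotaYanagisawa1993_periodicCylinderLogEstimate := by
  intro L hL
  obtain ⟨C, hC⟩ := hDC L hL
  -- the constants of the cell
  set c₁ : ℝ := ((volume (cylinderCell L : Set ℝ³)).toReal ^ (1 / 2 : ℝ))⁻¹ with hc₁
  set D : ℝ := 2 * Real.sqrt (1 + L ^ 2) with hD
  set σ : ℝ := ∑ i, ‖Module.finBasis ℝ ℝ³ i‖ with hσ
  have hc₁0 : 0 ≤ c₁ := by positivity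
  have hD0 : 0 ≤ D := by positivity
  have hσ0 : 0 ≤ σ := Finset.sum_nonneg fun i _ => norm_nonneg _
  set C' : ℝ := c₁ + (D + σ) * C with hC'
  have hC'0 : 0 ≤ C' := by positivity
  refine ⟨Real.toNNReal C', ?_⟩
  intro u₀ T hT u p hsol t ht n e₀ A hn he hA
  -- the slice
  have hv : ContDiffOn ℝ ∞ (u t) (closure (unitCylinder : Set ℝ³)) :=
    contDiffOn_slice_of_contDiffOn_uncurry hsol.smooth_velocity ht
  have hper : IsAxiallyPeriodic L (u t) := (hsol.periodic t ht).1
  have hdiv : ∀ x ∈ (unitCylinder : Set ℝ³), VectorCalculus.divergence (u t) x = 0 :=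
    hsol.euler.divFree t ht
  have hslip : ∀ x ∈ frontier (unitCylinder : Set ℝ³), ⟪u t x, eR x⟫ = 0 := hsol.euler.slip t ht
  -- the energy at time `t` is that of the datum
  have he' : eLpNorm (u t) 2 (volume.restrict (cylinderCell L : Set ℝ³)) ≤ e₀ := by
    rw [hsol.eLpNorm_two_eq hL ht, ← eSobolevDomainNorm_zero]
    exact he
  -- the gradient bound
  set R : ℝ := C * (e₀ + 1 + (1 + Real.posLog n) * A) with hR
  have hR0 : 0 ≤ R := by
    have := Real.posLog_nonneg (x := (n : ℝ))
    positivity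
  have hgrad : ∀ x ∈ (unitCylinder : Set ℝ³), ‖fderiv ℝ (u t) x‖ ≤ R :=
    hC (u t) hv hper hdiv hslip n e₀ A hn he' hA
  have hgrad' : ∀ x ∈ (cylinderCell L : Set ℝ³), ‖fderiv ℝ (u t) x‖ ≤ R :=
    fun x hx => hgrad x (cylinderCell_le_unitCylinder L hx)
  -- the sup bound
  have hvd : ∀ x ∈ (cylinderCell L : Set ℝ³), DifferentiableAt ℝ (u t) x := fun x hx => by
    have hxU : x ∈ unitCylinder := cylinderCell_le_unitCylinder L hx
    exact (hv.differentiableOn (by simp) x (subset_closure hxU)).differentiableAt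
      (closure_unitCylinder_mem_nhds hxU)
  have hsup : ∀ x ∈ (cylinderCell L : Set ℝ³), ‖u t x‖ ≤ c₁ * e₀ + D * R := fun x hx =>
    norm_le_of_eLpNorm_two_le_of_norm_fderiv_le hL hv.continuousOn hvd hgrad' he' hx
  -- the `W^{1,∞}` bound
  have ha0 : 0 ≤ c₁ * e₀ + D * R := by positivity
  have key := eSobolevDomainNorm_one_top_le_of_bounds (L := L) hv ha0 hR0 hsup hgrad'
  refine key.trans (ENNReal.ofReal_le_ofReal ?_)
  rw [Real.coe_toNNReal C' hC'0, hC', hR]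
  have h1 : (0 : ℝ) ≤ e₀ := e₀.coe_nonneg
  have h2 : (0 : ℝ) ≤ A := A.coe_nonneg
  have h3 : 0 ≤ Real.posLog (n : ℝ) := Real.posLog_nonneg
  have h4 : (e₀ : ℝ) ≤ e₀ + 1 + (1 + Real.posLog n) * A := by nlinarith
  nlinarith [mul_nonneg hc₁0 h1, mul_nonneg (mul_nonneg (add_nonneg hD0 hσ0) C.coe_nonneg)
    (show (0:ℝ) ≤ e₀ + 1 + (1 + Real.posLog n) * A by positivity)]

/-- **`Ferrari1993_periodicCylinderH3Bound` from the `H^s` energy inequality and the stationary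
log div–curl estimate** (Ferrari 1993, proof of Thm 2, (13)–(17) pp. 280–282; Shirota–Yanagisawa
1993, (14)–(17) p. 80): `Ferrari1993_periodicCylinderH3Bound_of_energyInequality_of_logEstimate`
with the logarithmic estimate supplied by
`ShirotaYanagisawa1993_periodicCylinderLogEstimate_of_divCurl`. Trust base of the a-priori bound
after this file: `Ferrari1993_periodicCylinderHsEnergyInequality` (Ferrari (13)–(14)) and
`ShirotaYanagisawa1993_periodicCylinderLogDivCurlEstimate` (one elliptic estimate for a single
field). [cite: Ferrari1993, proof of Thm 2, (13)–(17) pp. 280–282] -/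
theorem Ferrari1993_periodicCylinderH3Bound_of_energyInequality_of_divCurl
    (hA : Ferrari1993_periodicCylinderHsEnergyInequality)
    (hDC : ShirotaYanagisawa1993_periodicCylinderLogDivCurlEstimate) :
    Ferrari1993_periodicCylinderH3Bound :=
  Ferrari1993_periodicCylinderH3Bound_of_energyInequality_of_logEstimate hA
    (ShirotaYanagisawa1993_periodicCylinderLogEstimate_of_divCurl hDC)

end Literature.Analysis.FluidPDE
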